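import Mathlib.FieldTheory.Galois.Infinite
import Mathlib.RingTheory.RootsOfUnity.AlgebraicallyClosed
import Literature.NumberTheory.GaloisRepresentations.LocalReciprocityProofs
import Literature.NumberTheory.GaloisRepresentations.WeilGroupFrobeniusPowers
import Literature.AnabelianGeometry.AbsoluteAnabelian.MLFGaloisGroups
import HarnessLib

/-!
# Unramified subextensions of a local field through the Weil group (proofs only)

Auxiliaries for the DISCHARGE of the LCFT input `mlf_unramified_criterion` of
`MLFReciprocityInputs.lean` ([AbsAnab] Prop 1.2.1 (ii) proof, p. 11: "whether or not a finite
extension is unramified may be determined group-theoretically"; the discharge itself is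
`MLFUnramifiedCriterionProofs.lean`).  `F` is a non-archimedean local field of characteristic
`0` with residue field of cardinality `q`, `W_F ≤ Γ_F` its Weil group with `deg : W_F → ℤ`
(tree `GaloisRepresentations` trunk), `E ⊆ F̄` a finite subextension with Weil subgroup
`W_F ∩ G_E = fieldSubgroup F E`.

* `smul_eq_self_iff_pow_eq_one_of_forall_dvd` — a root of unity `ζ` of order prime to `p` is
  fixed by every `w ∈ W_F` with `n ∣ deg w` iff `ζ^(q^n - 1) = 1` (`w` acts by `ζ ↦ ζ^(q^deg w)`,
  tree `smul_eq_pow_of_isFrobPow`).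
* `index_fieldSubgroup_eq` — `[W_F : W_F ∩ G_E] = [Γ_F : G_E] = [E : F]` (`W_F` dense, `G_E`
  open; Krull).
* `exists_deg_generator` — a finite-index subgroup `U ≤ W_F` has a least positive degree `m`,
  every degree in `U` is a multiple of `m`, and `U = deg⁻¹(mℤ)` when `U ⊇ I_F`.
* `mem_iff_forall_fieldSubgroup_smul` — `x ∈ E ↔` `x` is fixed by `W_F ∩ G_E` (Galois
  correspondence + density).
* `natCard_primeToRootsOfUnity_eq_of_absInertia_le` / `absInertia_le_galFixing_of_natCard_eq` —
  **`I_F ≤ G_E` iff `#μ_{p'}(E) + 1 = q^[E:F]`**, and `#μ_{p'}(F) + 1 = q`.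

(Serre, *Local Fields* III §5, IV §4; Neukirch, *ANT* II (7.12)–(7.13).)  Theorems only; no new
definitions, no named facts.  HONEST FRAMING: classical, no bearing on [IUTchIII] Cor. 3.12.
[cite: MochizukiAbsAnab2004, Prop 1.2.1 (ii) proof p.11]
-/

noncomputable section

open Topology Filter Field ValuativeRel
open scoped Pointwise

namespace Literature.AnabelianGeometry.AbsoluteAnabelian

open Literature.NumberTheory.GaloisRepresentations
open Literature.NumberTheory.GaloisRepresentations.IsNonarchimedeanLocalField
open Literature.NumberTheory.GaloisRepresentations.LocalWeilDatum

universe u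

section Local

variable (F : Type u) [Field F] [ValuativeRel F] [TopologicalSpace F] [IsNonarchimedeanLocalField F]

/-! ### The degree map of the Weil group -/

/-- `deg (w ^ k) = k * deg w`, `ℕ`-exponent, unprimed names of the discharged facts.
[cite: MochizukiAbsAnab2004, Prop 1.2.1 (ii) proof p.11] -/
theorem isFrobPow_of_deg_eq {w : WeilGroup F} {n : ℤ} (h : WeilGroup.deg w = n) :
    IsFrobPow (WeilGroup.toAbsGalois F w) n :=
  (WeilGroup.deg_eq_iff IsFrobPow.mul_holds IsFrobPow.unique_holds).mp h

variable {F}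

/-- An element `w ∈ W_F` of degree `k ≥ 0` acts on a root of unity `ζ` of order `N` prime to the
residue characteristic by `ζ ↦ ζ^(q^k)`. [cite: MochizukiAbsAnab2004, Prop 1.2.1 (ii) proof p.11] -/
theorem smul_eq_pow_of_deg_eq' {N : ℕ} (hN : ¬ ringChar 𝓀[F] ∣ N) (hN0 : N ≠ 0)
    {w : WeilGroup F} {k : ℕ} (hw : WeilGroup.deg w = k) {ζ : AlgebraicClosure F}
    (hζ : ζ ^ N = 1) :
    WeilGroup.toAbsGalois F w • ζ = ζ ^ residueFieldCard F ^ k :=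
  smul_eq_pow_of_isFrobPow F hN hN0 (isFrobPow_of_deg_eq F hw) hζ

/-- If `ζ^(q^n) = ζ` then `ζ^(q^(n j)) = ζ`. [cite: MochizukiAbsAnab2004, Prop 1.2.1 (ii) proof p.11] -/
theorem pow_pow_mul_eq_self_of_pow_pow_eq_self {R : Type*} [Monoid R] {ζ : R} {q n : ℕ}
    (h : ζ ^ q ^ n = ζ) (j : ℕ) : ζ ^ q ^ (n * j) = ζ := by
  induction j with
  | zero => rw [mul_zero, pow_zero, pow_one]
  | succ j ih => rw [Nat.mul_succ, pow_add, pow_mul, ih, h]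

/-- **Frobenius powers and roots of unity.**  For a root of unity `ζ ∈ F̄` of order `N` prime
to the residue characteristic and `n ≥ 1`: every `w ∈ W_F` with `n ∣ deg w` fixes `ζ` iff
`ζ^(q^n - 1) = 1` (i.e. `ζ ∈ F_n = F(μ_{q^n-1})`, the unramified extension of degree `n`).
[cite: MochizukiAbsAnab2004, Prop 1.2.1 (ii) proof p.11] -/
theorem smul_eq_self_iff_pow_eq_one_of_forall_dvd {N : ℕ} (hN : ¬ ringChar 𝓀[F] ∣ N)
    (hN0 : N ≠ 0) (n : ℕ) {ζ : AlgebraicClosure F} (hζ : ζ ^ N = 1) :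
    (∀ w : WeilGroup F, (n : ℤ) ∣ WeilGroup.deg w → WeilGroup.toAbsGalois F w • ζ = ζ) ↔
      ζ ^ (residueFieldCard F ^ n - 1) = 1 := by
  have hζ0 : ζ ≠ 0 := by
    rintro rfl
    rw [zero_pow hN0] at hζ
    exact zero_ne_one hζ
  have hq1 : 1 ≤ residueFieldCard F ^ n := Nat.one_le_pow _ _ (by
    have := one_lt_residueFieldCard F; omega)
  -- `ζ^(q^n - 1) = 1 ↔ ζ^(q^n) = ζ`
  have key : ζ ^ (residueFieldCard F ^ n - 1) = 1 ↔ ζ ^ residueFieldCard F ^ n = ζ := by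
    constructor
    · intro h
      rw [← Nat.sub_add_cancel hq1, pow_succ, h, one_mul]
    · intro h
      apply mul_right_cancel₀ hζ0
      rw [← pow_succ, Nat.sub_add_cancel hq1, h, one_mul]
  rw [key]
  constructor
  · intro h
    -- a Weil element of degree exactly `n`
    obtain ⟨w, hw⟩ := WeilGroup.deg_surjective IsFrobPow.mul_holds IsFrobPow.unique_holds
      (exists_isFrobPow_holds F) (n : ℤ)
    have h1 := h w ⟨1, by rw [mul_one, hw]⟩
    rwa [smul_eq_pow_of_deg_eq' hN hN0 hw hζ] at h1
  · intro h w hw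
    obtain ⟨j, hj⟩ := hw
    rcases Int.eq_nat_or_neg j with ⟨i, rfl | rfl⟩
    · have hdeg : WeilGroup.deg w = ((n * i : ℕ) : ℤ) := by rw [hj]; push_cast; ring
      rw [smul_eq_pow_of_deg_eq' hN hN0 hdeg hζ]
      exact pow_pow_mul_eq_self_of_pow_pow_eq_self h i
    · have hdeg : WeilGroup.deg w⁻¹ = ((n * i : ℕ) : ℤ) := by
        rw [WeilGroup.deg_inv IsFrobPow.mul_holds IsFrobPow.unique_holds, hj]; push_cast; ring
      have h1 : WeilGroup.toAbsGalois F w⁻¹ • ζ = ζ := by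
        rw [smul_eq_pow_of_deg_eq' hN hN0 hdeg hζ]
        exact pow_pow_mul_eq_self_of_pow_pow_eq_self h i
      rw [map_inv, inv_smul_eq_iff] at h1
      exact h1.symm

/-! ### Indices: `[W_F : W_F ∩ G_E] = [Γ_F : G_E] = [E : F]` -/

/-- For a finite subextension `E ⊆ F̄`, the natural map `W_F / (W_F ∩ G_E) → Γ_F / G_E` is a
bijection (`W_F` is dense in `Γ_F` and `G_E` is open), so the indices agree.
[cite: MochizukiAbsAnab2004, Prop 1.2.1 (ii) proof p.11] -/
theorem index_fieldSubgroup_eq (E : IntermediateField F (AlgebraicClosure F))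
    [FiniteDimensional F E] :
    (fieldSubgroup F E).index = (galFixing F E).index := by
  classical
  let e : WeilGroup F ⧸ fieldSubgroup F E → absoluteGaloisGroup F ⧸ galFixing F E :=
    Quotient.map' (WeilGroup.toAbsGalois F) (by
      intro a b h
      rw [QuotientGroup.leftRel_apply] at h ⊢
      rw [fieldSubgroup, Subgroup.mem_comap, map_mul, map_inv] at h
      exact h)
  have hinj : Function.Injective e := by
    intro q₁ q₂ h
    induction q₁ using QuotientGroup.induction_on with | H a => ?_
    induction q₂ using QuotientGroup.induction_on with | H b => ?_
    have h' : (QuotientGroup.mk (WeilGroup.toAbsGalois F a) :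
        absoluteGaloisGroup F ⧸ galFixing F E) = QuotientGroup.mk (WeilGroup.toAbsGalois F b) := h
    refine QuotientGroup.eq.mpr ?_
    rw [fieldSubgroup, Subgroup.mem_comap, map_mul, map_inv]
    exact QuotientGroup.eq.mp h'
  have hsurj : Function.Surjective e := by
    intro y
    induction y using QuotientGroup.induction_on with | H γ => ?_
    -- the open coset `γ · G_E` meets the dense image of `W_F`
    have hopen : IsOpen (γ • (galFixing F E : Set (absoluteGaloisGroup F))) :=
      (isOpen_galFixing F E).smul γ
    obtain ⟨w, hw⟩ := (WeilGroup.denseRange_toAbsGalois_holds F).exists_mem_open hopen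
      ⟨γ, by simpa using Set.smul_mem_smul_set (a := γ) (galFixing F E).one_mem⟩
    obtain ⟨g, hg, hgw⟩ := hw
    have hgw' : γ * g = WeilGroup.toAbsGalois F w := hgw
    refine ⟨QuotientGroup.mk w, ?_⟩
    change (QuotientGroup.mk (WeilGroup.toAbsGalois F w) : absoluteGaloisGroup F ⧸ galFixing F E)
      = QuotientGroup.mk γ
    rw [QuotientGroup.eq, ← hgw', mul_inv_rev, mul_assoc, inv_mul_cancel, mul_one]
    exact (galFixing F E).inv_mem hg
  rw [Subgroup.index, Subgroup.index]
  exact Nat.card_eq_of_bijective e ⟨hinj, hsurj⟩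

omit [ValuativeRel F] [TopologicalSpace F] [IsNonarchimedeanLocalField F] in
/-- `[Γ_F : G_E] = [E : F]` (Krull; `F` of characteristic `0` so that `F̄/F` is Galois).
[cite: MochizukiAbsAnab2004, Prop 1.2.1 (ii) proof p.11] -/
theorem index_galFixing_eq_finrank [CharZero F] (E : IntermediateField F (AlgebraicClosure F))
    [FiniteDimensional F E] : (galFixing F E).index = Module.finrank F E := by
  rw [galFixing, Subgroup.index_comap_of_surjective _ (absoluteGaloisGroup.toAlgEquiv F).surjective,
    IntermediateField.finrank_eq_fixingSubgroup_index]

/-! ### Subgroups of `W_F` through their degrees -/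

/-- The subgroup `deg⁻¹(mℤ) ≤ W_F` has index `m` (`m ≥ 1`; `deg` is onto `ℤ`).
[cite: MochizukiAbsAnab2004, Prop 1.2.1 (ii) proof p.11] -/
theorem index_degMultiples {m : ℕ} (hm : 0 < m) (D : Subgroup (WeilGroup F))
    (hD : ∀ w, w ∈ D ↔ (m : ℤ) ∣ WeilGroup.deg w) : D.index = m := by
  classical
  haveI : NeZero m := ⟨hm.ne'⟩
  -- `deg mod m : W_F →* Multiplicative (ZMod m)`, surjective with kernel `D`
  let f : WeilGroup F →* Multiplicative (ZMod m) :=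
    (AddMonoidHom.toMultiplicative (Int.castAddHom (ZMod m))).comp
      (WeilGroup.degHom F IsFrobPow.mul_holds IsFrobPow.unique_holds)
  have hf : ∀ w, f w = Multiplicative.ofAdd ((WeilGroup.deg w : ℤ) : ZMod m) := fun w => rfl
  have hker : f.ker = D := by
    ext w
    rw [MonoidHom.mem_ker, hf, hD, ← ofAdd_zero, Multiplicative.ofAdd.injective.eq_iff,
      ZMod.intCast_zmod_eq_zero_iff_dvd]
  have hsurj : Function.Surjective f := by
    intro y
    obtain ⟨k, hk⟩ := ZMod.intCast_surjective (Multiplicative.toAdd y)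
    obtain ⟨w, hw⟩ := WeilGroup.deg_surjective IsFrobPow.mul_holds IsFrobPow.unique_holds
      (exists_isFrobPow_holds F) k
    exact ⟨w, by rw [hf, hw, hk]; rfl⟩
  rw [← hker, Subgroup.index_ker, MonoidHom.range_eq_top.mpr hsurj, Subgroup.card_top,
    Nat.card_eq_fintype_card, Fintype.card_multiplicative, ZMod.card]

/-- **Least positive degree.**  A subgroup `U ≤ W_F` of finite index contains an element of
least positive degree `m`, and every degree occurring in `U` is a multiple of `m`.
[cite: MochizukiAbsAnab2004, Prop 1.2.1 (ii) proof p.11] -/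
theorem exists_least_pos_deg (U : Subgroup (WeilGroup F)) [U.FiniteIndex] :
    ∃ m : ℕ, 0 < m ∧ (∃ w ∈ U, WeilGroup.deg w = m) ∧
      ∀ w ∈ U, (m : ℤ) ∣ WeilGroup.deg w := by
  classical
  have hmul : IsFrobPow.mul (F := F) := IsFrobPow.mul_holds
  have huniq : IsFrobPow.unique (F := F) := IsFrobPow.unique_holds
  -- an element of positive degree in `U`: a power of a degree-one element
  obtain ⟨φ, hφ⟩ := WeilGroup.deg_surjective hmul huniq (exists_isFrobPow_holds F) (1 : ℤ)
  obtain ⟨k, hk, -, hφk⟩ := Subgroup.exists_pow_mem_of_index_ne_zero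
    Subgroup.FiniteIndex.index_ne_zero φ (H := U)
  have hS : ∃ m : ℕ, 0 < m ∧ ∃ w ∈ U, WeilGroup.deg w = m :=
    ⟨k, hk, φ ^ k, hφk, by rw [WeilGroup.deg_pow, hφ, mul_one]⟩
  refine ⟨Nat.find hS, (Nat.find_spec hS).1, (Nat.find_spec hS).2, ?_⟩
  set m := Nat.find hS with hmdef
  obtain ⟨w₀, hw₀U, hw₀⟩ := (Nat.find_spec hS).2
  have hm : 0 < m := (Nat.find_spec hS).1
  intro w hw
  -- division with remainder of `deg w` by `m`
  set d := WeilGroup.deg w with hd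
  have hmz : (m : ℤ) ≠ 0 := by exact_mod_cast hm.ne'
  set r := d % m with hr
  set a := d / m with ha
  have hdecomp : d = m * a + r := by rw [hr, ha, add_comm]; exact (Int.emod_add_mul_ediv d m).symm
  have hr0 : 0 ≤ r := Int.emod_nonneg d hmz
  have hrm : r < m := Int.emod_lt_of_pos d (by exact_mod_cast hm)
  -- `w * w₀^(-a) ∈ U` has degree `r`
  have hmem : w * w₀ ^ (-a) ∈ U := U.mul_mem hw (U.zpow_mem hw₀U _)
  have hdeg : WeilGroup.deg (w * w₀ ^ (-a)) = r := by
    rw [WeilGroup.deg_mul hmul huniq, WeilGroup.deg_zpow, hw₀, ← hd, hdecomp]; ring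
  by_cases hr' : r = 0
  · rw [hdecomp, hr', add_zero]; exact ⟨a, rfl⟩
  · exfalso
    have hrpos : 0 < r := lt_of_le_of_ne hr0 (Ne.symm hr')
    obtain ⟨r', hr'⟩ := Int.eq_ofNat_of_zero_le hr0
    have hr'pos : 0 < r' := by rw [hr'] at hrpos; exact_mod_cast hrpos
    have hr'lt : r' < m := by rw [hr'] at hrm; exact_mod_cast hrm
    have hmin := Nat.find_min hS hr'lt
    exact hmin ⟨hr'pos, w * w₀ ^ (-a), hmem, by rw [hdeg, hr']⟩

/-! ### Membership in `E` through the Weil subgroup -/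

/-- Galois correspondence through the Weil group (`F` of characteristic `0`, `E/F` finite):
`x ∈ E` iff `x` is fixed by `W_F ∩ G_E` (tree `smul_eq_self_of_forall_fieldSubgroup` + Krull).
[cite: MochizukiAbsAnab2004, Prop 1.2.1 (ii) proof p.11] -/
theorem mem_iff_forall_fieldSubgroup_smul [CharZero F] (E : IntermediateField F (AlgebraicClosure F))
    [FiniteDimensional F E] (x : AlgebraicClosure F) :
    x ∈ E ↔ ∀ w ∈ fieldSubgroup F E, WeilGroup.toAbsGalois F w • x = x := by
  constructor
  · intro hx w hw
    exact (mem_fieldSubgroup_iff F).mp hw x hx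
  · intro h
    have hfix : ∀ σ ∈ galFixing F E, σ • x = x := fun σ hσ =>
      smul_eq_self_of_forall_fieldSubgroup F E h hσ
    rw [← InfiniteGalois.fixedField_fixingSubgroup E, IntermediateField.mem_fixedField_iff]
    intro g hg
    have := hfix ((absoluteGaloisGroup.toAlgEquiv F).symm g) (by
      rw [galFixing, Subgroup.mem_comap]
      simpa using hg)
    simpa [absoluteGaloisGroup.smul_def] using this

end Local

end Literature.AnabelianGeometry.AbsoluteAnabelian
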